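import Literature.NumberTheory.Sieve.PolynomialValuesSieveBounds
import HarnessLib

/-!
# Pairs of rough numbers: `#{n ≤ N : (n(n+h), P(z)) = 1} ≪ (h/φ(h)) N/log² z`

Topic `Literature/NumberTheory/Sieve`. Everything in this file is PROVED; no definition is introduced.
The two-dimensional upper-bound sieve for the prime-pair polynomial `f_h = X(X + h)`, `h` even,
obtained from the tree's Fundamental Lemma for polynomial sequences
(`abs_card_coprime_sub_le`, `PolynomialValuesSieveBounds.lean`, sieve dimension `2`):

* `polyRootCountMod_pairPoly` — `ω_{f_h}(p) = 1` if `p ∣ h`, `= 2` otherwise (`p` prime; the roots of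
  `n(n+h) ≡ 0 (mod p)` are `0` and `−h`);
* `prod_one_sub_pairRootCount_le` — the sifting density of the pair problem:
  `∏_{p<z} (1 − ω_{f_h}(p)/p) ≤ (h/φ(h))/log² z` (`(1 − 2/p) ≤ (1 − 1/p)²`, Mertens' elementary
  `log z ≤ ∏_{p<z}(1 − 1/p)⁻¹`, and `∏_{p ∣ h}(1 − 1/p)⁻¹ = h/φ(h)`);
* `card_pair_rough_le` — for even `h ≥ 2`, `N ≥ 1` and `2 ≤ z ≤ √N`:
  `#{1 ≤ n ≤ N : (n, P(z)) = 1, (n + h, P(z)) = 1} ≤ C (h/φ(h)) N/log² z` with an absolute `C`.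

This is the case `m₁ = m₂ = 0`, `w₁ = w₂ = z` of Matomäki–Merikoski's Lemma 3.1 (i)
(arXiv:2112.11412), there deduced from Henriot's Nair–Tenenbaum bound; the elementary sieve route
suffices for this case ("Theorems 1.3 and 1.4 … follow from Lemma 3.1 (i) with `w₁ = w₂ = X^{1/4}` and
`m₁ = m₂ = 0` unless `η` is large", §7).

## References

* K. Matomäki, J. Merikoski, IMRN 2023 (arXiv:2112.11412), Lemma 3.1 (i) (case `m₁ = m₂ = 0`) and §7.
  [cite: MatomakiMerikoski2023, Lemma 3.1 (i)]
* H. Halberstam, H.-E. Richert, *Sieve Methods* (1974), Thm 2.5 (Fundamental Lemma).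
  [cite: HalberstamRichert1974, Thm 2.5]
-/

noncomputable section

open Finset Real Polynomial

namespace Literature.NumberTheory.Sieve

namespace PairRough

/-! ### The root count of `X(X + h)` -/

/-- **`ω_{X(X+h)}(p) = 1 + [p ∤ h]`** at a prime `p`: the solutions of `n(n + h) ≡ 0 (mod p)` are
`n ≡ 0` and `n ≡ −h`, which coincide iff `p ∣ h`. [folklore] -/
theorem polyRootCountMod_pairPoly (h : ℕ) {p : ℕ} (hp : p.Prime) :
    polyRootCountMod ![(X * (X + C (h : ℤ)) : ℤ[X])] p = if p ∣ h then 1 else 2 := by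
  haveI := Fact.mk hp
  unfold polyRootCountMod
  simp only [Fin.prod_univ_one, Matrix.cons_val_zero, eval_mul, eval_X, eval_add, eval_C]
  have hcast : ∀ n : ℕ, ((p : ℤ) ∣ (n : ℤ) * ((n : ℤ) + (h : ℤ))) ↔
      ((n : ZMod p) * ((n : ZMod p) + (h : ZMod p)) = 0) := by
    intro n
    rw [← ZMod.intCast_zmod_eq_zero_iff_dvd]
    push_cast
    rfl
  simp_rw [hcast]
  have hval : ∀ n < p, ((n : ZMod p)).val = n := fun n hn => ZMod.val_natCast_of_lt hn
  split_ifs with hpk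
  · have hk0 : (h : ZMod p) = 0 := (ZMod.natCast_eq_zero_iff h p).mpr hpk
    have hset : (range p).filter
        (fun n : ℕ => (n : ZMod p) * ((n : ZMod p) + (h : ZMod p)) = 0) = {0} := by
      ext n
      simp only [mem_filter, mem_range, mem_singleton, hk0, add_zero, mul_self_eq_zero]
      constructor
      · rintro ⟨hn, h0⟩
        rw [← hval n hn, h0, ZMod.val_zero]
      · rintro rfl
        exact ⟨hp.pos, Nat.cast_zero⟩
    rw [hset, card_singleton]
  · have hk0 : (h : ZMod p) ≠ 0 := by rwa [Ne, ZMod.natCast_eq_zero_iff]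
    set r : ZMod p := -(h : ZMod p) with hr
    have hr0 : r.val ≠ 0 := by
      rw [Ne, ZMod.val_eq_zero, hr, neg_eq_zero]
      exact hk0
    have hset : (range p).filter
        (fun n : ℕ => (n : ZMod p) * ((n : ZMod p) + (h : ZMod p)) = 0) = {0, r.val} := by
      ext n
      simp only [mem_filter, mem_range, mem_insert, mem_singleton, mul_eq_zero]
      constructor
      · rintro ⟨hn, h0 | h0⟩
        · left
          rw [← hval n hn, h0, ZMod.val_zero]
        · right
          rw [← hval n hn]
          congr 1
          rw [hr]
          linear_combination h0
      · rintro (rfl | rfl)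
        · exact ⟨hp.pos, Or.inl Nat.cast_zero⟩
        · refine ⟨ZMod.val_lt r, Or.inr ?_⟩
          rw [ZMod.natCast_zmod_val, hr, neg_add_cancel]
    rw [hset, card_pair (Ne.symm hr0)]

/-- `ω_{X(X+h)}(2) ≤ 1` for even `h`, and `ω_{X(X+h)}(p) ≤ 2` for every prime `p`. [folklore] -/
theorem pairPoly_rootCount_bounds {h : ℕ} (hh : Even h) :
    polyRootCountMod ![(X * (X + C (h : ℤ)) : ℤ[X])] 2 ≤ 1 ∧
      ∀ p : ℕ, p.Prime → polyRootCountMod ![(X * (X + C (h : ℤ)) : ℤ[X])] p ≤ 2 := by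
  constructor
  · rw [polyRootCountMod_pairPoly h Nat.prime_two, if_pos (even_iff_two_dvd.mp hh)]
  · intro p hp
    rw [polyRootCountMod_pairPoly h hp]
    split_ifs <;> norm_num

/-! ### The sifting density `∏_{p<z} (1 − ω(p)/p) ≤ (h/φ(h))/log² z` -/

/-- **`∏_{p<z} (1 − ω_{X(X+h)}(p)/p) ≤ (h/φ(h))/(log z)²`** for `h ≥ 1`, `z > 1`.
[cite: MatomakiMerikoski2023, Lemma 3.1 (i) (the factor h/φ(h) X/log² X)] -/
theorem prod_one_sub_pairRootCount_le {h : ℕ} (hh : 1 ≤ h) {z : ℝ} (hz : 1 < z) :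
    ∏ p ∈ Nat.primesBelow ⌈z⌉₊, (1 - (polyRootCountMod ![(X * (X + C (h : ℤ)) : ℤ[X])] p : ℝ) / p) ≤
      ((h : ℝ) / (Nat.totient h : ℝ)) / (Real.log z) ^ 2 := by
  have hprime : ∀ p ∈ Nat.primesBelow ⌈z⌉₊, p.Prime := fun p hp => Nat.prime_of_mem_primesBelow hp
  -- factorwise: `1 − ω(p)/p ≤ (1 − 1/p)² · (if p ∣ h then (1 − 1/p)⁻¹ else 1)`
  have hfac : ∀ p ∈ Nat.primesBelow ⌈z⌉₊,
      (1 - (polyRootCountMod ![(X * (X + C (h : ℤ)) : ℤ[X])] p : ℝ) / p) ≤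
        (1 - (p : ℝ)⁻¹) ^ 2 * (if p ∣ h then (1 - (p : ℝ)⁻¹)⁻¹ else 1) := by
    intro p hp
    have hpp := hprime p hp
    have hp2 : (2 : ℝ) ≤ p := by exact_mod_cast hpp.two_le
    have hp0 : (0 : ℝ) < p := by linarith
    have h1p : 0 < 1 - (p : ℝ)⁻¹ := by
      have : (p : ℝ)⁻¹ ≤ 1 / 2 := by rw [inv_eq_one_div]; exact div_le_div_of_nonneg_left (by norm_num) (by norm_num) hp2
      linarith
    rw [polyRootCountMod_pairPoly h hpp]
    split_ifs with hph
    · rw [pow_two, mul_assoc, mul_inv_cancel₀ h1p.ne', mul_one]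
      push_cast
      rw [div_eq_mul_inv, one_mul]
    · push_cast
      rw [mul_one]
      have : (1 - (p : ℝ)⁻¹) ^ 2 = 1 - 2 / p + ((p : ℝ) ^ 2)⁻¹ := by field_simp; ring
      rw [this]
      have : 0 ≤ ((p : ℝ) ^ 2)⁻¹ := by positivity
      linarith
  have hnonneg : ∀ p ∈ Nat.primesBelow ⌈z⌉₊,
      0 ≤ (1 - (polyRootCountMod ![(X * (X + C (h : ℤ)) : ℤ[X])] p : ℝ) / p) := by
    intro p hp
    have hpp := hprime p hp
    have hp0 : (0 : ℝ) < p := by exact_mod_cast hpp.pos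
    rw [sub_nonneg, div_le_one hp0]
    have := polyRootCountMod_le ![(X * (X + C (h : ℤ)) : ℤ[X])] p
    exact_mod_cast this
  refine (Finset.prod_le_prod hnonneg hfac).trans ?_
  rw [Finset.prod_mul_distrib, Finset.prod_pow]
  -- `∏_{p<z} (1 − 1/p) ≤ 1/log z`
  have hM : Real.log z ≤ ∏ p ∈ Nat.primesBelow ⌈z⌉₊, (1 - (p : ℝ)⁻¹)⁻¹ := by
    have hM1 : 1 ≤ ⌈z⌉₊ := Nat.one_le_iff_ne_zero.mpr (Nat.pos_iff_ne_zero.mp (Nat.ceil_pos.mpr (by linarith)))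
    calc Real.log z ≤ Real.log (⌈z⌉₊ : ℕ) := Real.log_le_log (by linarith) (Nat.le_ceil z)
      _ ≤ _ := BombieriSieve.log_le_prod_primesBelow_inv hM1
  have hfacpos : ∀ p ∈ Nat.primesBelow ⌈z⌉₊, 0 < 1 - (p : ℝ)⁻¹ := by
    intro p hp
    have hp2 : (2 : ℝ) ≤ p := by exact_mod_cast (hprime p hp).two_le
    have : (p : ℝ)⁻¹ ≤ 1 / 2 := by rw [inv_eq_one_div]; exact div_le_div_of_nonneg_left (by norm_num) (by norm_num) hp2
    linarith
  have hPpos : 0 < ∏ p ∈ Nat.primesBelow ⌈z⌉₊, (1 - (p : ℝ)⁻¹) := Finset.prod_pos hfacpos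
  have hPinv : ∏ p ∈ Nat.primesBelow ⌈z⌉₊, (1 - (p : ℝ)⁻¹)⁻¹ = (∏ p ∈ Nat.primesBelow ⌈z⌉₊, (1 - (p : ℝ)⁻¹))⁻¹ :=
    Finset.prod_inv_distrib _
  have hlogpos : 0 < Real.log z := Real.log_pos hz
  have hP1 : (∏ p ∈ Nat.primesBelow ⌈z⌉₊, (1 - (p : ℝ)⁻¹)) * Real.log z ≤ 1 := by
    rw [hPinv] at hM
    calc (∏ p ∈ Nat.primesBelow ⌈z⌉₊, (1 - (p : ℝ)⁻¹)) * Real.log z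
        ≤ (∏ p ∈ Nat.primesBelow ⌈z⌉₊, (1 - (p : ℝ)⁻¹)) * (∏ p ∈ Nat.primesBelow ⌈z⌉₊, (1 - (p : ℝ)⁻¹))⁻¹ :=
          mul_le_mul_of_nonneg_left hM hPpos.le
      _ = 1 := mul_inv_cancel₀ hPpos.ne'
  -- `∏_{p<z, p ∣ h} (1 − 1/p)⁻¹ ≤ h/φ(h)`
  have htot : ∏ p ∈ Nat.primesBelow ⌈z⌉₊, (if p ∣ h then (1 - (p : ℝ)⁻¹)⁻¹ else 1) ≤
      (h : ℝ) / (Nat.totient h : ℝ) := by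
    rw [← Finset.prod_filter]
    have hsub : (Nat.primesBelow ⌈z⌉₊).filter (fun p => p ∣ h) ⊆ h.primeFactors := by
      intro p hp
      rw [mem_filter] at hp
      exact Nat.mem_primeFactors.mpr ⟨hprime p hp.1, hp.2, by omega⟩
    have hφ : (h : ℝ) / (Nat.totient h : ℝ) = ∏ p ∈ h.primeFactors, (1 - (p : ℝ)⁻¹)⁻¹ := by
      rw [Literature.NumberTheory.LFunctions.MertensBound.totient_eq_mul_prod_one_sub_inv h, Finset.prod_inv_distrib]
      have hh0 : (h : ℝ) ≠ 0 := by exact_mod_cast (show h ≠ 0 by omega)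
      have hprod : ∏ p ∈ h.primeFactors, (1 - 1 / (p : ℝ)) ≠ 0 := by
        refine Finset.prod_ne_zero_iff.mpr fun p hp => ?_
        have hp2 : (2 : ℝ) ≤ p := by exact_mod_cast (Nat.prime_of_mem_primeFactors hp).two_le
        have : 1 / (p : ℝ) ≤ 1 / 2 := div_le_div_of_nonneg_left (by norm_num) (by norm_num) hp2
        linarith
      simp_rw [one_div] at hprod ⊢
      field_simp
    rw [hφ]
    refine Finset.prod_le_prod_of_subset_of_one_le hsub (fun p hp => ?_) (fun p hp _ => ?_)
    · have := hfacpos p (mem_filter.mp hp).1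
      exact inv_nonneg.mpr this.le
    · have hp2 : (2 : ℝ) ≤ p := by exact_mod_cast (Nat.prime_of_mem_primeFactors hp).two_le
      have h1 : (p : ℝ)⁻¹ ≤ 1 / 2 := by rw [inv_eq_one_div]; exact div_le_div_of_nonneg_left (by norm_num) (by norm_num) hp2
      rw [one_le_inv_iff₀]
      constructor <;> [linarith; linarith [inv_nonneg.mpr (by linarith : (0:ℝ) ≤ p)]]
  -- combine
  calc (∏ p ∈ Nat.primesBelow ⌈z⌉₊, (1 - (p : ℝ)⁻¹)) ^ 2 *
        ∏ p ∈ Nat.primesBelow ⌈z⌉₊, (if p ∣ h then (1 - (p : ℝ)⁻¹)⁻¹ else 1)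
      ≤ (1 / Real.log z) ^ 2 * ((h : ℝ) / (Nat.totient h : ℝ)) := by
        refine mul_le_mul ?_ htot (Finset.prod_nonneg fun p hp => ?_) (by positivity)
        · refine pow_le_pow_left₀ hPpos.le ?_ 2
          rw [le_div_iff₀ hlogpos]; exact hP1
        · split_ifs
          · exact inv_nonneg.mpr (hfacpos p hp).le
          · exact zero_le_one
    _ = ((h : ℝ) / (Nat.totient h : ℝ)) / (Real.log z) ^ 2 := by
        field_simp

/-! ### The pair count -/

/-- `log z ≤ 4 N^{1/8}` hence `√N · log⁴ z ≤ 256 N` when `1 < z`, `z² ≤ N`. [folklore] -/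
theorem sqrt_mul_log_pow_four_le {N z : ℝ} (hz : 1 < z) (hzN : z ^ 2 ≤ N) :
    Real.sqrt N * Real.log z ^ 4 ≤ 256 * N := by
  have hz0 : 0 < z := by linarith
  have hN1 : 1 < N := by nlinarith
  have hN0 : 0 < N := by linarith
  -- `log z ≤ (1/2) log N = 4 log (N^{1/8}) ≤ 4 (N^{1/8} − 1) < 4 N^{1/8}`
  have hlogz : Real.log z ≤ Real.log N / 2 := by
    have : Real.log (z ^ 2) ≤ Real.log N := Real.log_le_log (by positivity) hzN
    rw [Real.log_pow] at this; push_cast at this; linarith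
  set t : ℝ := N ^ ((1 : ℝ) / 8) with ht
  have ht0 : 0 < t := Real.rpow_pos_of_pos hN0 _
  have hlogt : Real.log t = Real.log N / 8 := by rw [ht, Real.log_rpow hN0]; ring
  have hlogN : Real.log N ≤ 8 * t := by
    have := Real.log_le_sub_one_of_pos ht0
    rw [hlogt] at this; linarith
  have hlz0 : 0 ≤ Real.log z := (Real.log_pos hz).le
  have hlz : Real.log z ≤ 4 * t := by linarith
  have ht4 : t ^ 4 = Real.sqrt N := by
    rw [ht, ← Real.rpow_natCast, ← Real.rpow_mul hN0.le, Real.sqrt_eq_rpow]; norm_num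
  have hpow : Real.log z ^ 4 ≤ (4 * t) ^ 4 := pow_le_pow_left₀ hlz0 hlz 4
  have hsN : Real.sqrt N * Real.sqrt N = N := Real.mul_self_sqrt hN0.le
  calc Real.sqrt N * Real.log z ^ 4 ≤ Real.sqrt N * (4 * t) ^ 4 :=
        mul_le_mul_of_nonneg_left hpow (Real.sqrt_nonneg N)
    _ = 256 * (Real.sqrt N * t ^ 4) := by ring
    _ = 256 * N := by rw [ht4, hsN]

/-- **Pairs of rough numbers** (Matomäki–Merikoski Lemma 3.1 (i), case `m₁ = m₂ = 0`, `w₁ = w₂ = z`,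
positive sign): there is an absolute `C` such that for even `h ≥ 2`, `N ≥ 1` and `2 ≤ z ≤ √N`,
`#{1 ≤ n ≤ N : (n, P(z)) = 1 ∧ (n + h, P(z)) = 1} ≤ C (h/φ(h)) N/log² z`.
Proof: the two-sided Fundamental Lemma for the polynomial sequence `{n(n+h) : n ≤ N}` (dimension `2`,
`ω(2) = 1`, `ω(p) ≤ 2`; the tree's `abs_card_coprime_sub_le`) at level `D = √N`, the density bound
`prod_one_sub_pairRootCount_le` and `√N e⁸ log² z ≤ 256 e⁸ N/log² z`.
[cite: MatomakiMerikoski2023, Lemma 3.1 (i)] -/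
theorem card_pair_rough_le : ∃ C : ℝ, 0 < C ∧ ∀ h : ℕ, Even h → 1 ≤ h → ∀ N : ℕ, ∀ z : ℝ,
    2 ≤ z → z ^ 2 ≤ (N : ℝ) →
    (#((Ioc 0 N).filter fun n : ℕ => n.Coprime (primesProdBelow z) ∧ (n + h).Coprime (primesProdBelow z)) : ℝ) ≤
      C * ((h : ℝ) / (Nat.totient h : ℝ)) * N / (Real.log z) ^ 2 := by
  set Cω : ℝ := SieveSequence.flConst 2 (2 * Real.exp (17 + 12 / Real.log 2)) with hCω
  have hCω0 : 0 < Cω := SieveSequence.flConst_pos (by norm_num) (by positivity)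
  refine ⟨1 + Cω + 256 * Real.exp 8, by positivity, ?_⟩
  intro h hh hh1 N z hz hzN
  set f : ℤ[X] := X * (X + C (h : ℤ)) with hf
  obtain ⟨h2, hle⟩ := pairPoly_rootCount_bounds hh
  have hz1 : 1 < z := by linarith
  have hz0 : 0 < z := by linarith
  have hN1 : (1 : ℝ) < N := by nlinarith
  have hN0 : (0 : ℝ) < N := by linarith
  have hlog : 0 < Real.log z := Real.log_pos hz1
  -- identify the filter with the polynomial one
  have heval : ∀ n : ℕ, f.eval (n : ℤ) = ((n * (n + h) : ℕ) : ℤ) := by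
    intro n; rw [hf]; simp
  have hfilter : ((Ioc 0 N).filter fun n : ℕ => n.Coprime (primesProdBelow z) ∧ (n + h).Coprime (primesProdBelow z)) =
      (Ioc 0 N).filter fun n : ℕ => (f.eval (n : ℤ)).natAbs.Coprime (primesProdBelow z) := by
    refine Finset.filter_congr fun n _ => ?_
    rw [heval, Int.natAbs_natCast, Nat.coprime_mul_iff_left]
  -- the two-sided Fundamental Lemma at level `D = √N`
  have hzD : z ≤ Real.sqrt N := by
    rw [Real.le_sqrt hz0.le hN0.le]; exact hzN
  have hx : ∀ n ∈ Ioc 0 N, 0 < f.eval (n : ℤ) ∧ ((f.eval (n : ℤ) : ℤ) : ℝ) ≤ (N : ℝ) * (N + h) := by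
    intro n hn
    obtain ⟨hn0, hnN⟩ := mem_Ioc.mp hn
    rw [heval]
    constructor
    · have : 0 < n * (n + h) := Nat.mul_pos hn0 (by omega)
      exact_mod_cast this
    · have h1 : (n : ℝ) ≤ N := by exact_mod_cast hnN
      have h2 : ((n * (n + h) : ℕ) : ℝ) = (n : ℝ) * (n + h) := by push_cast; ring
      rw [show (((n * (n + h) : ℕ) : ℤ) : ℝ) = ((n * (n + h) : ℕ) : ℝ) by norm_cast, h2]
      have hn0' : (0 : ℝ) ≤ n := Nat.cast_nonneg n
      nlinarith
  have hFL := abs_card_coprime_sub_le h2 hle (N := N) hz hzD hx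
  rw [← hfilter] at hFL
  set V : ℝ := ∏ p ∈ Nat.primesBelow ⌈z⌉₊, (1 - (polyRootCountMod ![f] p : ℝ) / p) with hV
  have hVle : V ≤ ((h : ℝ) / (Nat.totient h : ℝ)) / (Real.log z) ^ 2 := prod_one_sub_pairRootCount_le hh1 hz1
  have hV0 : 0 ≤ V := by
    have := prod_one_sub_rootCount_pos h2 hle z
    exact this.le
  have hexp : Real.exp (-(Real.log (Real.sqrt N) / Real.log z)) ≤ 1 := by
    rw [Real.exp_le_one_iff, neg_nonpos]
    exact div_nonneg (Real.log_nonneg (by rw [Real.le_sqrt (by norm_num) hN0.le]; linarith)) hlog.le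
  have herr : Real.sqrt N * (Real.exp 8 * Real.log z ^ 2) ≤ 256 * Real.exp 8 * N / (Real.log z) ^ 2 := by
    rw [le_div_iff₀ (by positivity)]
    have := sqrt_mul_log_pow_four_le hz1 hzN
    nlinarith [Real.exp_pos 8]
  have htot1 : (1 : ℝ) ≤ (h : ℝ) / (Nat.totient h : ℝ) := by
    rw [le_div_iff₀ (by exact_mod_cast Nat.totient_pos.mpr hh1), one_mul]
    exact_mod_cast Nat.totient_le h
  have hmain := (abs_le.mp hFL).2
  -- assemble
  calc (#((Ioc 0 N).filter fun n : ℕ => n.Coprime (primesProdBelow z) ∧ (n + h).Coprime (primesProdBelow z)) : ℝ)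
      ≤ N * V + Cω * N * V * Real.exp (-(Real.log (Real.sqrt N) / Real.log z)) +
          Real.sqrt N * (Real.exp 8 * Real.log z ^ 2) := by linarith
    _ ≤ N * V + Cω * N * V + 256 * Real.exp 8 * N / (Real.log z) ^ 2 := by
        have : Cω * N * V * Real.exp (-(Real.log (Real.sqrt N) / Real.log z)) ≤ Cω * N * V :=
          mul_le_of_le_one_right (by positivity) hexp
        linarith
    _ ≤ (1 + Cω) * N * (((h : ℝ) / (Nat.totient h : ℝ)) / (Real.log z) ^ 2) + 256 * Real.exp 8 * N / (Real.log z) ^ 2 := by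
        have : (1 + Cω) * N * V ≤ (1 + Cω) * N * (((h : ℝ) / (Nat.totient h : ℝ)) / (Real.log z) ^ 2) :=
          mul_le_mul_of_nonneg_left hVle (by positivity)
        linarith
    _ = ((1 + Cω) * ((h : ℝ) / (Nat.totient h : ℝ)) + 256 * Real.exp 8) * N / (Real.log z) ^ 2 := by
        field_simp
    _ ≤ (1 + Cω + 256 * Real.exp 8) * ((h : ℝ) / (Nat.totient h : ℝ)) * N / (Real.log z) ^ 2 := by
        refine div_le_div_of_nonneg_right (mul_le_mul_of_nonneg_right ?_ hN0.le) (by positivity)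
        nlinarith [Real.exp_pos 8, htot1, hCω0]

end PairRough

end Literature.NumberTheory.Sieve
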